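import Summits.NavierStokesRegularity.NavierStokesRegularity.Theorems.EfficiencyFloorMaximiserSetRigidityProfileLiouville
import Literature.Analysis.FluidPDE.KNSSRegularityGalilean
import HarnessLib

/-!
# Route `EfficiencyFloor`, crux `MaximiserSetRigidity` (stmt-NavierStokesRegularity-25512), part (b):
# no DRIFTING non-rotating relative equilibrium is a normalised maximiser — UNCONDITIONAL

Helper file (`--supports stmt-NavierStokesRegularity-25512`). Sequel to `…ProfileLiouville`
(`collapseLiouville_noRotation_noDrift`, `partB_noRotation_noDrift`: the case `a = 0`, `W = 0`). The drift `a`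
is removed by a translation: if `νΔm − (m·∇)m − ∇π = (a·∇)m + c′(m + (x·∇)m)` with `c′ ≠ 0`, then
`m̃(y) = m(y − a/c′)`, `π̃(y) = π(y − a/c′)` solve `νΔm̃ − (m̃·∇)m̃ − ∇π̃ = c′(m̃ + (y·∇)m̃)`, with the same
admissibility (`D⁰, D¹, D² ∈ L²` are translation invariant) and the same enstrophy. Hence:

* `collapseLiouville_noRotation` — (L⁺) at `W = 0`, any drift `a`: no admissible `m` with `Z(m) > 0` solves the
  profile equation with `c′ > 0` (translation + Tsai 1998 via `collapseLiouville_noRotation_noDrift`);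
* `partB_noRotation` — for `c, ν > 0` and every `m` satisfying the item's normalised-maximiser clause verbatim:
  for all smooth `π`, all `a ∈ ℝ³` and all `c′ ∈ ℝ`, the item's (b)-clause instantiated at `W = 0` holds
  (`c′ > 0` is forced by `rate_pos_of_profile`, then `collapseLiouville_noRotation`). UNCONDITIONAL.

So part (b) of stmt-25512 is now PROVED for all non-rotating relative equilibria (steady, travelling,
self-similarly collapsing / expanding, with any drift); the rotating case `W ≠ 0` remains, reduced to (L⁺) by
`partB_of_collapseLiouville`. HONEST FRAMING: part (a), the rotating case of (b), `RigidExit`, `LerayFloorGap`,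
`ProductionEfficiencyDecay` and Navier–Stokes regularity stay OPEN; no summit statement is proved. Tools:
the tree's translation lemmas `fderiv_comp_sub_right`, `iteratedFDeriv_comp_sub_right`,
`laplacian_comp_sub_right`, `divergence_comp_sub_right` (`KNSSRegularityGalilean`). [folklore]
-/

noncomputable section

-- the problem directory repeats the summit name (`NavierStokesRegularity/NavierStokesRegularity`)
set_option linter.dupNamespace false

namespace Summit.NavierStokesRegularity.NavierStokesRegularity.Theorems

namespace MaximiserSetRigidity

namespace ProfileLiouville

open MeasureTheory Set Filter Topology Module InnerProductSpace
open scoped RealInnerProductSpace Laplacian ContDiff ENNReal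
open Literature.Analysis Literature.Analysis.FluidPDE

/-- Translation invariance of the Sobolev integrals `∫ |Dᵏ m(· − d)|² = ∫ |Dᵏ m|²`. [folklore] -/
theorem lintegral_iteratedFDeriv_translate (k : ℕ) (m : (EuclideanSpace ℝ (Fin 3)) → (EuclideanSpace ℝ (Fin 3)))
    (d : EuclideanSpace ℝ (Fin 3)) :
    (∫⁻ y, ‖iteratedFDeriv ℝ k (fun y => m (y - d)) y‖ₑ ^ 2) = ∫⁻ x, ‖iteratedFDeriv ℝ k m x‖ₑ ^ 2 := by
  have e : (fun y => ‖iteratedFDeriv ℝ k (fun y => m (y - d)) y‖ₑ ^ 2) =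
      fun y => (fun x => ‖iteratedFDeriv ℝ k m x‖ₑ ^ 2) (y - d) := by
    funext y
    simp only [iteratedFDeriv_comp_sub_right]
  rw [e]
  exact lintegral_sub_right_eq_self (fun x => ‖iteratedFDeriv ℝ k m x‖ₑ ^ 2) d

/-- Translation of the curl: `curl (m(· − d)) y = curl m (y − d)`. [folklore] -/
theorem curl_translate (m : (EuclideanSpace ℝ (Fin 3)) → (EuclideanSpace ℝ (Fin 3))) (d y : EuclideanSpace ℝ (Fin 3)) :
    curl (fun y => m (y - d)) y = curl m (y - d) := by
  rw [curl_eq_curlCLM, fderiv_comp_sub_right, ← curl_eq_curlCLM]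

/-- **(L⁺) for non-rotating profiles with drift (translation + Tsai 1998).** No smooth divergence-free `m` with
`D⁰m, D¹m, D²m ∈ L²` and `Z(m) > 0` solves `νΔm − (m·∇)m − ∇π = (a·∇)m + c′(m + (x·∇)m)` (`π` smooth, any
`a ∈ ℝ³`; the item's right-hand side at `W = 0`) with `c′ > 0`, `ν > 0`. [cite: Tsai1998, Thm 1] -/
theorem collapseLiouville_noRotation (ν : ℝ) (hν : 0 < ν)
    (m : (EuclideanSpace ℝ (Fin 3)) → (EuclideanSpace ℝ (Fin 3))) (π : (EuclideanSpace ℝ (Fin 3)) → ℝ)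
    (a : EuclideanSpace ℝ (Fin 3)) (c' : ℝ)
    (hadm : ContDiff ℝ (⊤ : ℕ∞) m ∧ Literature.Analysis.FluidPDE.VectorCalculus.IsDivFree m ∧ (∫⁻ x,
      ‖iteratedFDeriv ℝ 0 m x‖ₑ ^ 2 < ⊤) ∧ (∫⁻ x, ‖iteratedFDeriv ℝ 1 m x‖ₑ ^ 2 < ⊤) ∧ (∫⁻ x, ‖iteratedFDeriv
      ℝ 2 m x‖ₑ ^ 2 < ⊤))
    (hZ : 0 < (∫ x, ‖Literature.Analysis.FluidPDE.curl m x‖ ^ 2)) (hπ : ContDiff ℝ (⊤ : ℕ∞) π)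
    (hc' : 0 < c') :
    ¬ (∀ x : EuclideanSpace ℝ (Fin 3), ν • Laplacian.laplacian m x - Literature.Analysis.FluidPDE.convect m m x -
      gradient π x = fderiv ℝ m x a +
        (fderiv ℝ m x ((0 : (EuclideanSpace ℝ (Fin 3)) →L[ℝ] (EuclideanSpace ℝ (Fin 3))) x) -
          (0 : (EuclideanSpace ℝ (Fin 3)) →L[ℝ] (EuclideanSpace ℝ (Fin 3))) (m x)) + c' • (m x + fderiv ℝ m x x)) := by
  intro heq
  obtain ⟨hm, hdiv, h0, h1, h2⟩ := hadm
  -- the translate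
  set d : EuclideanSpace ℝ (Fin 3) := c'⁻¹ • a with hd
  set mt : (EuclideanSpace ℝ (Fin 3)) → (EuclideanSpace ℝ (Fin 3)) := fun y => m (y - d) with hmt_def
  set πt : (EuclideanSpace ℝ (Fin 3)) → ℝ := fun y => π (y - d) with hπt_def
  have hτ : ContDiff ℝ (⊤ : ℕ∞) (fun y : EuclideanSpace ℝ (Fin 3) => y - d) := contDiff_id.sub contDiff_const
  have hmt : ContDiff ℝ (⊤ : ℕ∞) mt := hm.comp hτ
  have hπt : ContDiff ℝ (⊤ : ℕ∞) πt := hπ.comp hτ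
  have hdivt : VectorCalculus.IsDivFree mt := fun y => by
    rw [hmt_def, divergence_comp_sub_right]
    exact hdiv _
  have h0t : ∫⁻ y, ‖iteratedFDeriv ℝ 0 mt y‖ₑ ^ 2 < ⊤ := by
    rw [hmt_def, lintegral_iteratedFDeriv_translate]; exact h0
  have h1t : ∫⁻ y, ‖iteratedFDeriv ℝ 1 mt y‖ₑ ^ 2 < ⊤ := by
    rw [hmt_def, lintegral_iteratedFDeriv_translate]; exact h1
  have h2t : ∫⁻ y, ‖iteratedFDeriv ℝ 2 mt y‖ₑ ^ 2 < ⊤ := by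
    rw [hmt_def, lintegral_iteratedFDeriv_translate]; exact h2
  have hZt : 0 < (∫ y, ‖curl mt y‖ ^ 2) := by
    have e : (fun y => ‖curl mt y‖ ^ 2) = fun y => (fun x => ‖curl m x‖ ^ 2) (y - d) := by
      funext y
      simp only [hmt_def, curl_translate]
    rw [e, integral_sub_right_eq_self (fun x => ‖curl m x‖ ^ 2) d]
    exact hZ
  -- the translated equation
  have heqt : ∀ y : EuclideanSpace ℝ (Fin 3), ν • Δ mt y - convect mt mt y - gradient πt y = fderiv ℝ mt y 0 +
      (fderiv ℝ mt y ((0 : (EuclideanSpace ℝ (Fin 3)) →L[ℝ] (EuclideanSpace ℝ (Fin 3))) y) -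
        (0 : (EuclideanSpace ℝ (Fin 3)) →L[ℝ] (EuclideanSpace ℝ (Fin 3))) (mt y)) + c' • (mt y + fderiv ℝ mt y y) := by
    intro y
    have h := heq (y - d)
    simp only [map_zero, zero_apply, sub_zero, zero_add] at h ⊢
    have eΔ : Δ mt y = Δ m (y - d) := laplacian_comp_sub_right m d y
    have eD : fderiv ℝ mt y = fderiv ℝ m (y - d) := fderiv_comp_sub_right m d y
    have eπ : gradient πt y = gradient π (y - d) := by
      unfold gradient
      rw [fderiv_comp_sub_right π d y]
    have ec : convect mt mt y = convect m m (y - d) := by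
      unfold convect
      rw [eD]
    rw [eΔ, ec, eπ, eD, h]
    have hy : (fderiv ℝ m (y - d)) (y - d) = fderiv ℝ m (y - d) y - c'⁻¹ • fderiv ℝ m (y - d) a := by
      rw [map_sub, hd, map_smul]
    rw [hy, smul_add, smul_add, smul_sub, smul_smul, mul_inv_cancel₀ hc'.ne', one_smul]
    abel
  exact collapseLiouville_noRotation_noDrift ν hν mt πt c' ⟨hmt, hdivt, h0t, h1t, h2t⟩ hZt hπt hc' heqt

/-- **Part (b) of `MaximiserSetRigidity` at `W = 0` (any drift) — UNCONDITIONAL.** For `c, ν > 0` and every `m`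
satisfying the item's normalised-maximiser clause verbatim: for all smooth `π`, all `a ∈ ℝ³` and all `c′ ∈ ℝ`,
`¬ (νΔm − (m·∇)m − ∇π = (a·∇)m + c′(m + (x·∇)m))` — no normalised Lu–Doering maximiser is a steady,
travelling, or self-similarly collapsing / expanding (possibly drifting) Navier–Stokes profile. `c′ > 0` is
forced by (EB) (`ProfileEnstrophyBalance.rate_pos_of_profile`); the collapsing case is
`collapseLiouville_noRotation`. Only rotating relative equilibria (`W ≠ 0`) of part (b) remain open. [folklore] -/
theorem partB_noRotation (c ν : ℝ) (hc : 0 < c) (hν : 0 < ν)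
    (m : (EuclideanSpace ℝ (Fin 3)) → (EuclideanSpace ℝ (Fin 3)))
    (hm : ((ContDiff ℝ (⊤ : ℕ∞) m ∧ Literature.Analysis.FluidPDE.VectorCalculus.IsDivFree m ∧ (∫⁻ x, ‖iteratedFDeriv ℝ 0
      m x‖ₑ ^ 2 < ⊤) ∧ (∫⁻ x, ‖iteratedFDeriv ℝ 1 m x‖ₑ ^ 2 < ⊤) ∧ (∫⁻ x, ‖iteratedFDeriv ℝ 2 m x‖ₑ ^ 2 < ⊤))
      ∧ 0 < (∫ x, ‖Literature.Analysis.FluidPDE.curl m x‖ ^ 2) ∧ (∫ x, ⟪Literature.Analysis.FluidPDE.curl m x,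
      fderiv ℝ m x (Literature.Analysis.FluidPDE.curl m x)⟫_ℝ) = c * (∫ x, ‖Literature.Analysis.FluidPDE.curl
      m x‖ ^ 2) ^ (3 / 4 : ℝ) * (∫ x, Literature.Analysis.FluidPDE.frobeniusNormSq (fderiv ℝ
      (Literature.Analysis.FluidPDE.curl m) x)) ^ (3 / 4 : ℝ) ∧ (∫ x,
      Literature.Analysis.FluidPDE.frobeniusNormSq (fderiv ℝ (Literature.Analysis.FluidPDE.curl m) x)) = 81 *
      c ^ 4 / (256 * ν ^ 4) * (∫ x, ‖Literature.Analysis.FluidPDE.curl m x‖ ^ 2) ^ 3)) :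
    ∀ (π : (EuclideanSpace ℝ (Fin 3)) → ℝ) (a : EuclideanSpace ℝ (Fin 3)) (c' : ℝ), ContDiff ℝ (⊤ : ℕ∞) π →
      ¬ (∀ x : EuclideanSpace ℝ (Fin 3), ν • Laplacian.laplacian m x - Literature.Analysis.FluidPDE.convect m m x -
        gradient π x = fderiv ℝ m x a +
          (fderiv ℝ m x ((0 : (EuclideanSpace ℝ (Fin 3)) →L[ℝ] (EuclideanSpace ℝ (Fin 3))) x) -
            (0 : (EuclideanSpace ℝ (Fin 3)) →L[ℝ] (EuclideanSpace ℝ (Fin 3))) (m x)) + c' • (m x + fderiv ℝ m x x)) := by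
  intro π a c' hπ heq
  have hW : ∀ x y : EuclideanSpace ℝ (Fin 3),
      ⟪(0 : (EuclideanSpace ℝ (Fin 3)) →L[ℝ] (EuclideanSpace ℝ (Fin 3))) x, y⟫_ℝ =
        -⟪x, (0 : (EuclideanSpace ℝ (Fin 3)) →L[ℝ] (EuclideanSpace ℝ (Fin 3))) y⟫_ℝ := fun x y => by simp
  have hc' : 0 < c' := ProfileEnstrophyBalance.rate_pos_of_profile c ν hc hν m hm hπ hW heq
  exact collapseLiouville_noRotation ν hν m π a c' hm.1 hm.2.1 hπ hc' heq

/-- **Part (b) of `MaximiserSetRigidity` from the ROTATING collapse Liouville theorem alone.** After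
`partB_noRotation` (all non-rotating relative equilibria excluded unconditionally) the exact residual analytic
content of the item's part (b) is (L⁺_rot): no admissible `m` (`D⁰m, D¹m, D²m ∈ L²`) with `Z(m) > 0` solves the
relative-equilibrium profile equation with a NON-ZERO skew-adjoint `W` and a collapsing rate `c′ > 0` (a rotating,
possibly drifting, backward self-similar profile of finite energy — known mathematics via the
Escauriaza–Seregin–Šverák `L^{3,∞}` regularity theorem applied to the orbit `t ↦ g(t)·m`, whose `L³` norm is
constant, but not typed in the tree; the Type-I-decay version is Pineau–Vicol 2026 / the Perelman–Tsai conjecture).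
Given (L⁺_rot), every `m` satisfying the item's normalised-maximiser clause verbatim (for `c, ν > 0`) satisfies
the item's (b)-clause verbatim: `W = 0` is `partB_noRotation`; for `W ≠ 0` the rate is `c′ > 0` by
`rate_pos_of_profile` and (L⁺_rot) applies. HONEST FRAMING: an implication; (L⁺_rot), part (a), `RigidExit`,
`LerayFloorGap`, `ProductionEfficiencyDecay` and Navier–Stokes regularity stay OPEN. [folklore] -/
theorem partB_of_rotatingCollapseLiouville (c ν : ℝ) (hc : 0 < c) (hν : 0 < ν)
    (hLrot : ∀ (m : EuclideanSpace ℝ (Fin 3) → EuclideanSpace ℝ (Fin 3)) (π : EuclideanSpace ℝ (Fin 3) → ℝ) (a :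
      EuclideanSpace ℝ (Fin 3)) (W : EuclideanSpace ℝ (Fin 3) →L[ℝ] EuclideanSpace ℝ (Fin 3)) (c' : ℝ),
      (ContDiff ℝ (⊤ : ℕ∞) m ∧ Literature.Analysis.FluidPDE.VectorCalculus.IsDivFree m ∧ (∫⁻ x,
      ‖iteratedFDeriv ℝ 0 m x‖ₑ ^ 2 < ⊤) ∧ (∫⁻ x, ‖iteratedFDeriv ℝ 1 m x‖ₑ ^ 2 < ⊤) ∧ (∫⁻ x, ‖iteratedFDeriv
      ℝ 2 m x‖ₑ ^ 2 < ⊤)) → 0 < (∫ x, ‖Literature.Analysis.FluidPDE.curl m x‖ ^ 2) → ContDiff ℝ (⊤ : ℕ∞) π →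
      (∀ x y : EuclideanSpace ℝ (Fin 3), ⟪W x, y⟫_ℝ = -⟪x, W y⟫_ℝ) → W ≠ 0 → 0 < c' →
      ¬ (∀ x : EuclideanSpace ℝ (Fin 3), ν • Laplacian.laplacian m x - Literature.Analysis.FluidPDE.convect m m x -
        gradient π x = fderiv ℝ m x a + (fderiv ℝ m x (W x) - W (m x)) + c' • (m x + fderiv ℝ m x x)))
    (m : EuclideanSpace ℝ (Fin 3) → EuclideanSpace ℝ (Fin 3))
    (hm : ((ContDiff ℝ (⊤ : ℕ∞) m ∧ Literature.Analysis.FluidPDE.VectorCalculus.IsDivFree m ∧ (∫⁻ x, ‖iteratedFDeriv ℝ 0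
      m x‖ₑ ^ 2 < ⊤) ∧ (∫⁻ x, ‖iteratedFDeriv ℝ 1 m x‖ₑ ^ 2 < ⊤) ∧ (∫⁻ x, ‖iteratedFDeriv ℝ 2 m x‖ₑ ^ 2 < ⊤))
      ∧ 0 < (∫ x, ‖Literature.Analysis.FluidPDE.curl m x‖ ^ 2) ∧ (∫ x, ⟪Literature.Analysis.FluidPDE.curl m x,
      fderiv ℝ m x (Literature.Analysis.FluidPDE.curl m x)⟫_ℝ) = c * (∫ x, ‖Literature.Analysis.FluidPDE.curl
      m x‖ ^ 2) ^ (3 / 4 : ℝ) * (∫ x, Literature.Analysis.FluidPDE.frobeniusNormSq (fderiv ℝ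
      (Literature.Analysis.FluidPDE.curl m) x)) ^ (3 / 4 : ℝ) ∧ (∫ x,
      Literature.Analysis.FluidPDE.frobeniusNormSq (fderiv ℝ (Literature.Analysis.FluidPDE.curl m) x)) = 81 *
      c ^ 4 / (256 * ν ^ 4) * (∫ x, ‖Literature.Analysis.FluidPDE.curl m x‖ ^ 2) ^ 3)) :
    ∀ (π : EuclideanSpace ℝ (Fin 3) → ℝ) (a : EuclideanSpace ℝ (Fin 3)) (W : EuclideanSpace ℝ (Fin 3) →L[ℝ]
    EuclideanSpace ℝ (Fin 3)) (c' : ℝ), ContDiff ℝ (⊤ : ℕ∞) π → (∀ x y : EuclideanSpace ℝ (Fin 3), ⟪W x, y⟫_ℝ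
    = -⟪x, W y⟫_ℝ) → ¬ (∀ x : EuclideanSpace ℝ (Fin 3), ν • Laplacian.laplacian m x -
    Literature.Analysis.FluidPDE.convect m m x - gradient π x = fderiv ℝ m x a + (fderiv ℝ m x (W x) - W (m
    x)) + c' • (m x + fderiv ℝ m x x)) := by
  intro π a W c' hπ hW heq
  by_cases hW0 : W = 0
  · subst hW0
    exact partB_noRotation c ν hc hν m hm π a c' hπ heq
  · have hc' : 0 < c' := ProfileEnstrophyBalance.rate_pos_of_profile c ν hc hν m hm hπ hW heq
    exact hLrot m π a W c' hm.1 hm.2.1 hπ hW hW0 hc' heq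

end ProfileLiouville

end MaximiserSetRigidity

end Summit.NavierStokesRegularity.NavierStokesRegularity.Theorems

end
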